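import Summits.BirchSwinnertonDyer.BirchSwinnertonDyer.Theorems.ErratumRoadFiveNonSurjCornerHybridTwinMuAnDeepCore
import HarnessLib

/-!
# Route `ErratumRoadFive` (rung K2), crux `NonSurjCorner` (item stmt-BirchSwinnertonDyer-19065), line `Lines/hybrid.lean`:
# THE ∃-RECUT OF THE CONVERSE HALF — slots 1 (deep Kolyvagin certificates) + 2b (μ = 0 at the twins of the deep pairs) of r18 MERGED into
# ONE DEEP WITNESS per deep pair: SOME Heegner field, SOME Manin-good frame, a certificate there (if deep) and μ = 0 at THAT ONE twist
# (cell `bsd-stepL`, seat `bsd-stepL-corner-p1` g18; `--supports stmt-BirchSwinnertonDyer-19065 --as helper`)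

WHY THIS FILE. After the `Ш_an`-cuts (g14: slot 1; g18: slot 2) the converse half of a corner pair `(E, p)` is asked only at the DEEP pairs
(`#Ш(E)_an = s`, `0 < ord_p s`), but still ∀-shaped: certificates at EVERY deep frame of EVERY admissible Heegner field `K`, and μ = 0 at EVERY
Friedberg–Hoffstein twist. Its CONSUMER (x11b3's `missingLowerBoundAt_of_indexLowerBoundAt_of_upperTwist`) uses ONE field `K`, ONE Manin-good
frame `(Dt, H, ι, P)`, ONE certificate and the Euler half of ONE twist `E^{(d_K)}` — the field was merely CHOSEN by the glue through Friedberg–Hoffstein.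
So, exactly as RULING 33 re-cut (Tw) at 3 to «SOME odd Heegner field» (`CornerTwistWitnessAt`), the converse half of 19065 can be keyed on ONE
∃-shaped DEEP WITNESS per deep pair. Per pair this is ONE computation's worth of data (one `K` of our choosing — e.g. one whose twist class carries
a μ-certificate of lane B — one frame, one non-divisible derived point); class-wide it is the same open mathematics (Kolyvagin's refined conjecture at
a non-surjective image with `p ∥ N`, and Greenberg's μ = 0 at one twist), asked existentially.
* §1 `X11b.missingLowerBoundAt_corner_of_deepWitnessAt` — the converse half of a corner pair from a deep witness (+ the class-wide twin-Euler supplier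
  `htwU`: μ-clause ⟹ `MissingUpperBoundAt`, which the glue builds from Kato 12.4 + §17.13 V′∕VI′∕XI′ + Stein–Wuthrich 6.1 + Greenberg–Stevens);
* §2 `X11b.erratumRoadFive_nonSurjCorner_of_deepWitness_of_kolyJMax_of_multiUpper_of_lowerLeafTwinDeep_of_twinUpper_of_casselsTate` — the hybrid
  composition (p640833) with `(hZan, hdivD)` replaced by `(htwU, hWit)`; `sha_dvd_analyticSha` (it served only the ∀-shaped converse assembly's surjective-twist branch, impossible on the
  corner), `nonempty_modularParametrizationData`, Stein–Wuthrich 6.1 ×2 and Greenberg–Stevens (they served only the twin's Euler half, now inside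
  `htwU`) leave the composition's binder list.
r18's slots imply the witness (sequel `…HybridDeepWitness`: Friedberg–Hoffstein + Mazur's Manin datum produce the field and the frame).

HONEST FRAMING: TWO THEOREMS (no definition, no named fact, no `sorry`); CONDITIONAL on every displayed binder; no stub is proved — two open inputs
are asked existentially instead of universally; 19065 NOT closed by this file; nothing about any curve's BSD; BSD is not advanced; T7.
References (locators only): [cite: Cha2005, Thm. 21 and Rmk. 25] [cite: McCallumLMS1991, §5 Cor. 5.6] [cite: JetchevSkinnerWan2017, §7.4.1–7.4.2]
[cite: Kato2004Asterisque, Thm. 12.4, §17.13] [cite: GreenbergLNM1716, §1 Conj. 1.11 (p. 61)] [cite: Miller2011LMS, Def. 1.1].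
-/

set_option autoImplicit false
set_option linter.dupNamespace false -- `Summit.BirchSwinnertonDyer.BirchSwinnertonDyer` (summit = problem), tree-wide

noncomputable section

open scoped Classical NumberField MatrixGroups ModularForm

namespace Summit.BirchSwinnertonDyer.Rank1Residual.X11b

open CongruenceSubgroup WeierstrassCurve NumberField IsDedekindDomain Field
  Literature.NumberTheory.EllipticCurves
  Literature.NumberTheory.EllipticCurves.ModularForms
  Literature.NumberTheory.EllipticCurves.Rank1Residual
  Literature.NumberTheory.EllipticCurves.Rank1Residual.Typed
  Literature.NumberTheory.EllipticCurves.Wuthrich2014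
  Literature.NumberTheory.EllipticCurves.SteinWuthrich2013
  Literature.NumberTheory.EllipticCurves.GreenbergVatsal2000
  Literature.NumberTheory.EllipticCurves.EmertonPollackWeston2006
  Literature.NumberTheory.QuadraticFields.Quadratic
  Literature.NumberTheory.GaloisRepresentations
  Summit.BirchSwinnertonDyer.Rank1Residual
  Summit.BirchSwinnertonDyer.Rank1Residual.RankZeroHeightFree
  Summit.BirchSwinnertonDyer.Rank1Residual.X11b.Three.Koly
  Summit.BirchSwinnertonDyer.BirchSwinnertonDyer.Theorems

/-! ### §1 The converse half of a corner pair from ONE deep witness (∃-shape: one Heegner field, one Manin-good frame) -/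

/-- **The converse half `ord_p #Ш(E)_an ≤ ord_p #Ш(E)` of a corner pair from ONE DEEP WITNESS.** For a (T4′) corner pair `(E, p)` and a
WITNESS — an imaginary quadratic `K` (`|d_K| > 4`, Heegner for `N_E`, `L(E^{(d_K)},1) ≠ 0`), a Manin-good Heegner datum `(Dt, H, ι, P)` at `K`
(`p ∤ c(Dt)`, `P ∈ E(K)` THE Heegner point), (i) a refined-Kolyvagin certificate of level `≤ t = ord_p ∏_ℓ c_ℓ(E)` at that frame IF the frame is deep
(`y_K ∈ p^{t+1} E(K)`; a shallow frame certifies itself by the conductor-1 certificate, `nonSurjCornerKolyZ_of_bottom_not_pow_divisible'`), and (ii)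
analytic `μ = 0` (item 19948's allowable-root clause) at the globally minimal models of the twist `E^{(d_K)}` — the converse half follows: certificate ⟹
`IndexLowerBoundAt` (Cha 2005 Rmk. 25 lower, `indexLowerBoundAt_corner_of_certificates`), μ-clause ⟹ the twin's Euler half (`htwU`, supplied by the
glue from Kato 12.4 + §17.13 V′∕VI′∕XI′ + Stein–Wuthrich + Greenberg–Stevens), both ⟹ the ℚ-level lower half by x11b3's
`missingLowerBoundAt_of_indexLowerBoundAt_of_upperTwist` (GZ index identity; `p ∤ u_K` from `|d_K| > 4`). The ∃-RECUT of slots 1 + 2b of r18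
(cf. RULING 33's ∃-recut of (Tw) at 3): ONE field and ONE frame per deep pair instead of ALL. PUBLISHED binders `hGZ hKo hGZK hmod hrec hD36 hChaL`.
CONDITIONAL on the witness and `htwU`; nothing booked. [cite: Cha2005, Thm. 21 and Rmk. 25 (pp. 173–175)] [cite: JetchevSkinnerWan2017, §7.4.1 (p. 30)]
[cite: McCallumLMS1991, §5 Cor. 5.6 (p. 310)] [cite: Miller2011LMS, Def. 1.1] -/
theorem missingLowerBoundAt_corner_of_deepWitnessAt
    (hGZ : ∀ (N : ℕ) [NeZero N] (W : WeierstrassCurve ℚ) (K : Type) [Field K] [NumberField K],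
      gross_zagier N W K)
    (hKo : ∀ (N : ℕ) [NeZero N] (W : WeierstrassCurve ℚ) (K : Type) [Field K] [NumberField K],
      kolyvagin N W K)
    (hGZK : rank_eq_analyticRank_of_analyticRank_le_one) (hmod : hasEntireLFunction_rat)
    (hrec : ∀ (N : ℕ) [NeZero N] (W : WeierstrassCurve ℚ) (K : Type) [Field K] [NumberField K],
      heegnerPointOfConductor_one_galoisConj N W K)
    (hD36 : ∀ (N : ℕ) [NeZero N] (W : WeierstrassCurve ℚ) (K : Type) [Field K] [NumberField K],
      phi_heegnerTau_mem_singularModuliField N W K)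
    (hChaL : Cha2005.rmk25_pow_dvd_card_sha_primary_of_certificate)
    (W : WeierstrassCurve ℚ) [W.IsElliptic] [W.IsGloballyMinimal] (p : ℕ) [Fact p.Prime]
    (hX : ClassX11b W p) (hns : ¬ Surj W p) (h57 : p = 5 ∨ p = 7)
    (hv : p ∣ padicValInt p W.minimalDiscriminantInt) (hnr : ¬ Ram W p)
    -- the twin's Euler half from the μ-clause (Kato at the twin; supplied by the glue)
    (htwU : ∀ (Wd : WeierstrassCurve ℚ) [Wd.IsElliptic] [Wd.IsGloballyMinimal],
      ClassX11a Wd p → ¬ Surj Wd p → p ∣ padicValInt p Wd.minimalDiscriminantInt →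
      (∀ {N : ℕ} [NeZero N] (f : CuspForm (Gamma0 N) 2), IsNewformOf Wd f →
        ∀ (ϖ : ℚ), (ϖ : ℝ) * Wd.realPeriodRat = plusPeriod f →
        ∀ (a : ℚ_[p]) (L : PowerSeries ℚ_[p]),
          (Wd.HasSplitMultiplicativeReductionAtPrime p → a = 1) →
          (¬ Wd.HasSplitMultiplicativeReductionAtPrime p → a = -1) →
          IsMultPAdicLFunctionOf f p a L →
          ∃ n : ℕ, ‖PowerSeries.coeff n (PowerSeries.C ((ϖ : ℚ) : ℚ_[p]) * L)‖ = 1) →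
      Typed.MissingUpperBoundAt Wd p)
    -- the DEEP WITNESS at this pair
    (hwit : ∃ (N : ℕ) (_ : NeZero N) (K : Type) (_ : Field K) (_ : NumberField K)
        (Dt : ModularParametrizationData W N) (H : HeegnerDatum N (NumberField.discr K)) (ι : K →+* ℂ)
        (P : (W.baseChange K).toAffine.Point),
        W.conductorNorm ℤ = N ∧ IsImaginaryQuadratic K ∧ 4 < (NumberField.discr K).natAbs ∧
        SatisfiesHeegnerHypothesis N K ∧ (W.quadraticTwist (NumberField.discr K : ℚ)).entireLFunction 1 ≠ 0 ∧
        WeierstrassCurve.Affine.Point.map ι.toRatAlgHom P = heegnerPointComplex Dt H ∧ ¬ (p : ℤ) ∣ Dt.c ∧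
        -- (i) at THIS frame, if it is deep, a refined-Kolyvagin certificate of level ≤ t (a shallow frame certifies itself)
        ((∃ (d₁ : KolyvaginHeegnerData Dt H.β ι 1) (y : (W.baseChange K).toAffine.Point),
            WeierstrassCurve.Affine.Point.map (W' := W) (algebraMap K (ringClassField K ι 1)).toRatAlgHom y =
              d₁.derivedPoint ∧
            ∃ Q : (W.baseChange K).toAffine.Point, ((p ^ (padicValNat p W.tamagawaProduct + 1) : ℕ) : ℤ) • Q = y) →
          ∃ M : ℕ, M ≤ padicValNat p W.tamagawaProduct ∧ CertificateAt Dt H.β ι p M) ∧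
        -- (ii) analytic μ = 0 (19948's allowable-root clause) at the globally minimal models of THIS twist E^{(d_K)}
        (∀ (Wd : WeierstrassCurve ℚ) [Wd.IsElliptic] [Wd.IsGloballyMinimal] (Cd : VariableChange ℚ),
          Cd • W.quadraticTwist (NumberField.discr K : ℚ) = Wd →
          ClassX11a Wd p → ¬ Surj Wd p → p ∣ padicValInt p Wd.minimalDiscriminantInt →
          ∀ {N : ℕ} [NeZero N] (f : CuspForm (Gamma0 N) 2), IsNewformOf Wd f →
          ∀ (ϖ : ℚ), (ϖ : ℝ) * Wd.realPeriodRat = plusPeriod f →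
          ∀ (a : ℚ_[p]) (L : PowerSeries ℚ_[p]),
            (Wd.HasSplitMultiplicativeReductionAtPrime p → a = 1) →
            (¬ Wd.HasSplitMultiplicativeReductionAtPrime p → a = -1) →
            IsMultPAdicLFunctionOf f p a L →
            ∃ n : ℕ, ‖PowerSeries.coeff n (PowerSeries.C ((ϖ : ℚ) : ℚ_[p]) * L)‖ = 1)) :
    Typed.MissingLowerBoundAt W p := by
  have hp : p.Prime := Fact.out
  have hp5 : 5 ≤ p := by rcases h57 with h | h <;> omega
  obtain ⟨hr, hp2, hmult, hirr⟩ := id hX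
  obtain ⟨N, _, K, _, _, Dt, H, ι, P, hN, hK, hdisc, hHN, hLt, hP, hc, hcert, hμK⟩ := hwit
  subst hN
  have hHp : SatisfiesHeegnerHypothesis p K :=
    SatisfiesHeegnerHypothesis.of_dvd (dvd_conductorNorm_of_mult hmult) hHN
  -- `p ∤ u_K` from `|d_K| > 4`
  have hμ : ¬ p ∣ Units.torsionOrder K := by
    haveI : IsTotallyComplex K := hK.2
    have hneg : NumberField.discr K < 0 := discr_neg_of_finrank_eq_two K hK.1
    have habs : ((NumberField.discr K).natAbs : ℤ) = -NumberField.discr K :=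
      Int.ofNat_natAbs_of_nonpos hneg.le
    have h4 : NumberField.discr K < -4 := by
      have : (4 : ℤ) < ((NumberField.discr K).natAbs : ℤ) := by exact_mod_cast hdisc
      omega
    rw [Literature.NumberTheory.DiophantineGeometry.torsionOrder_eq_two_of_discr_lt hK.1 h4]
    intro h2
    have := Nat.le_of_dvd two_pos h2
    omega
  have hPinf : ¬ IsOfFinAddOrder P :=
    not_isOfFinAddOrder_of_heegner_of_analyticRank_eq_one W _ K Dt H ι P (hGZ _ W K) hmod hr hK hHN
      hLt hP
  -- (i) the certificate at this frame — deep: the witness; shallow: the conductor-1 certificate is free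
  have hZ : ∃ M : ℕ, M ≤ padicValNat p W.tamagawaProduct ∧ CertificateAt Dt H.β ι p M := by
    by_cases hdeep : ∃ (d₁ : KolyvaginHeegnerData Dt H.β ι 1) (y : (W.baseChange K).toAffine.Point),
        WeierstrassCurve.Affine.Point.map (W' := W) (algebraMap K (ringClassField K ι 1)).toRatAlgHom y =
          d₁.derivedPoint ∧
        ∃ Q : (W.baseChange K).toAffine.Point, ((p ^ (padicValNat p W.tamagawaProduct + 1) : ℕ) : ℤ) • Q = y
    · exact hcert hdeep
    · push Not at hdeep
      exact nonSurjCornerKolyZ_of_bottom_not_pow_divisible' W p _ K Dt H.β ι hX hns h57 hv hnr rfl hK hdisc hHN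
        hHp H.dvd_sq_sub hc (fun d₁ y hy hQ => by obtain ⟨Q, hQ⟩ := hQ; exact hdeep d₁ y hy Q hQ)
  have hLd : IndexLowerBoundAt W p K P :=
    indexLowerBoundAt_corner_of_certificates hGZ hKo hmod hrec hD36 hChaL W p _ K Dt H ι P hX hp5 rfl
      hK hdisc hHN hLt hP hPinf hZ
  -- (ii) a globally minimal model of the twist and its Euler half from the μ-clause
  have hD0 : (NumberField.discr K : ℚ) ≠ 0 := by exact_mod_cast NumberField.discr_ne_zero K
  haveI hEt : (W.quadraticTwist (NumberField.discr K : ℚ)).IsElliptic :=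
    W.isElliptic_quadraticTwist hD0
  obtain ⟨Cd, hCd⟩ := hasGlobalMinimalModel_rat_holds (W.quadraticTwist (NumberField.discr K : ℚ))
  haveI : (Cd • W.quadraticTwist (NumberField.discr K : ℚ)).IsGloballyMinimal := hCd
  set Wd : WeierstrassCurve ℚ := Cd • W.quadraticTwist (NumberField.discr K : ℚ) with hWd_def
  have hWd : Cd • W.quadraticTwist (NumberField.discr K : ℚ) = Wd := rfl
  have hrd : Wd.analyticRank = 0 := by
    rw [hWd_def, analyticRank_smul]
    exact analyticRank_eq_zero_of_entireLFunction_one_ne_zero _ hLt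
  have hXa : ClassX11a Wd p := classX11a_twist_of_not_ram W p hX hnr K hK hHN Cd hWd hrd
  have hnsd : ¬ Surj Wd p := not_surj_twist_model W p hD0 hns Cd hWd
  have hsq := isSquare_discr_padic_of_heegner K hK hHN p (dvd_conductorNorm_of_mult hmult)
  have hvd : p ∣ padicValInt p Wd.minimalDiscriminantInt := by
    rw [padicValInt_minimalDiscriminantInt_twist_eq W p hD0 hsq Cd hWd]
    exact hv
  have hup : Typed.MissingUpperBoundAt Wd p :=
    htwU Wd hXa hnsd hvd (fun f hf ϖ hϖ a L hsa hna hL ↦ hμK Wd Cd hWd hXa hnsd hvd f hf ϖ hϖ a L hsa hna hL)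
  exact missingLowerBoundAt_of_indexLowerBoundAt_of_upperTwist W p K Dt H ι P (hGZ _ W K)
    (hKo _ W K) hGZK hmod hr hp5 hmult hirr hK hHN hP hc hμ hLt Wd Cd hWd hup hLd

/-! ### §2 The hybrid composition keyed on the deep witness -/

/-- **`…HybridTwinMuAnDeepCore` §1 with slots 1 + 2b MERGED into ONE ∃-shaped DEEP WITNESS per deep pair.** Same statement and proof as
`erratumRoadFive_nonSurjCorner_of_kolyZShaAn_of_kolyJMax_of_multiUpper_of_lowerLeafTwinDeep_of_twinMultDivisibilityDeep_of_casselsTate` (p640833) except that the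
two converse-half binders — `hZan` (certificates at EVERY deep frame of every admissible `K`) and `hdivD` (Kato at EVERY Friedberg–Hoffstein twin) — are
replaced by `hWit`: at each DEEP corner pair, SOME `K` and SOME Manin-good frame with a certificate (if deep) and μ = 0 at that one twist (§1's
witness), plus the class-wide twin-Euler supplier `htwU` (μ-clause ⟹ `MissingUpperBoundAt`, from Kato's facts in the glue). The Friedberg–Hoffstein
field of the converse half is no longer chosen by the glue (`hFHs` is used only by the MAX road now). Upper half by carrier profile VERBATIM.
CONDITIONAL on every binder; does NOT close 19065; nothing booked; T7.
[cite: Miller2011LMS, Def. 1.1] [cite: Cha2005, Thm. 21 and Rmk. 25 (pp. 173–175)] [cite: McCallumLMS1991, §5 Cor. 5.6] -/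
theorem erratumRoadFive_nonSurjCorner_of_deepWitness_of_kolyJMax_of_multiUpper_of_lowerLeafTwinDeep_of_twinUpper_of_casselsTate
    (hGZ : ∀ (N : ℕ) [NeZero N] (W : WeierstrassCurve ℚ) (K : Type) [Field K] [NumberField K],
      gross_zagier N W K)
    (hKo : ∀ (N : ℕ) [NeZero N] (W : WeierstrassCurve ℚ) (K : Type) [Field K] [NumberField K],
      kolyvagin N W K)
    (hGZK : rank_eq_analyticRank_of_analyticRank_le_one) (hmod : hasEntireLFunction_rat)
    (hnf : exists_isNewformOf)
    (hFHs : friedbergHoffstein_exists_heegnerField_split_twist_ne_zero)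
    (hMaz : mazur_not_dvd_maninConstant_of_odd)
    (hrec : ∀ (N : ℕ) [NeZero N] (W : WeierstrassCurve ℚ) (K : Type) [Field K] [NumberField K],
      heegnerPointOfConductor_one_galoisConj N W K)
    (hD36 : ∀ (N : ℕ) [NeZero N] (W : WeierstrassCurve ℚ) (K : Type) [Field K] [NumberField K],
      phi_heegnerTau_mem_singularModuliField N W K)
    (hChaL : Cha2005.rmk25_pow_dvd_card_sha_primary_of_certificate)
    (hCT : ∀ (K : Type) [Field K] [NumberField K], casselsTate_levelInputs K)
    (h372 : GrossLMS1991.prop37_2_frobeniusCongruence)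
    (h₄ℓ : ∀ (Wd : WeierstrassCurve ℚ) [Wd.IsElliptic] [Wd.IsGloballyMinimal] (p : ℕ) [Fact p.Prime],
      ClassX11a Wd p → ¬ Surj Wd p → (p = 5 ∨ p = 7) → p ∣ padicValInt p Wd.minimalDiscriminantInt →
      ¬ X11a.ShaAnUnit Wd p → Typed.MissingLowerBoundAt Wd p)
    (hJmax : ∀ (W : WeierstrassCurve ℚ) [W.IsElliptic] [W.IsGloballyMinimal] [NeZero (W.conductorNorm ℤ)]
      (p : ℕ) [Fact p.Prime] (K : Type) [Field K] [NumberField K]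
      (Dt : ModularParametrizationData W (W.conductorNorm ℤ)) (β : ℤ) (ι : K →+* ℂ),
      p ∣ W.tamagawaProduct →
      ClassX11b W p → ¬ Surj W p → (p = 5 ∨ p = 7) → p ∣ padicValInt p W.minimalDiscriminantInt →
      ¬ Ram W p → IsImaginaryQuadratic K → 4 < (NumberField.discr K).natAbs →
      SatisfiesHeegnerHypothesis (W.conductorNorm ℤ) K → SatisfiesHeegnerHypothesis p K →
      (4 * (W.conductorNorm ℤ : ℤ)) ∣ β ^ 2 - NumberField.discr K → ¬ (p : ℤ) ∣ Dt.c →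
      ∀ (v : HeightOneSpectrum (𝓞 ℚ)) (s : ℕ), s ≤ padicValNat p (W.tamagawaNumberAt v) →
        ∀ (n : ℕ) (d : KolyvaginHeegnerData Dt β ι n), Squarefree n →
          (∀ ℓ ∈ n.primeFactors, Zhang2014.IsKolyvaginPrime (W.conductorNorm ℤ) W K p ℓ ∧
            s ≤ Zhang2014.kolyvaginIndex W p ℓ) → PDiv d p s)
    (hUmulti : ∀ (W : WeierstrassCurve ℚ) [W.IsElliptic] [W.IsGloballyMinimal] (p : ℕ) [Fact p.Prime],
      ClassX11b W p → ¬ Surj W p → (p = 5 ∨ p = 7) → p ∣ padicValInt p W.minimalDiscriminantInt →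
      ¬ Ram W p → p ∣ W.tamagawaProduct →
      (∀ v : HeightOneSpectrum (𝓞 ℚ), padicValNat p (W.tamagawaNumberAt v) < padicValNat p W.tamagawaProduct) →
      Typed.MissingUpperBoundAt W p)
    -- the twin's Euler half from the μ-clause, class-wide in SHAPE (Kato 12.4 + §17.13 + SW 6.1 + GS in the glue; consumed only at the witness twin)
    (htwU : ∀ (Wd : WeierstrassCurve ℚ) [Wd.IsElliptic] [Wd.IsGloballyMinimal] (p : ℕ) [Fact p.Prime],
      ClassX11a Wd p → ¬ Surj Wd p → p ∣ padicValInt p Wd.minimalDiscriminantInt →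
      (∀ {N : ℕ} [NeZero N] (f : CuspForm (Gamma0 N) 2), IsNewformOf Wd f →
        ∀ (ϖ : ℚ), (ϖ : ℝ) * Wd.realPeriodRat = plusPeriod f →
        ∀ (a : ℚ_[p]) (L : PowerSeries ℚ_[p]),
          (Wd.HasSplitMultiplicativeReductionAtPrime p → a = 1) →
          (¬ Wd.HasSplitMultiplicativeReductionAtPrime p → a = -1) →
          IsMultPAdicLFunctionOf f p a L →
          ∃ n : ℕ, ‖PowerSeries.coeff n (PowerSeries.C ((ϖ : ℚ) : ℚ_[p]) * L)‖ = 1) →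
      Typed.MissingUpperBoundAt Wd p)
    -- ONE DEEP WITNESS per deep corner pair (slots 1 + 2b of r18, ∃-recut)
    (hWit : ∀ (W : WeierstrassCurve ℚ) [W.IsElliptic] [W.IsGloballyMinimal] (p : ℕ) [Fact p.Prime],
      ClassX11b W p → ¬ Surj W p → (p = 5 ∨ p = 7) → p ∣ padicValInt p W.minimalDiscriminantInt →
      ¬ Ram W p → (∃ s : ℚ, shaAn W = (s : ℂ) ∧ 0 < padicValRat p s) →
      ∃ (N : ℕ) (_ : NeZero N) (K : Type) (_ : Field K) (_ : NumberField K)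
        (Dt : ModularParametrizationData W N) (H : HeegnerDatum N (NumberField.discr K)) (ι : K →+* ℂ)
        (P : (W.baseChange K).toAffine.Point),
        W.conductorNorm ℤ = N ∧ IsImaginaryQuadratic K ∧ 4 < (NumberField.discr K).natAbs ∧
        SatisfiesHeegnerHypothesis N K ∧ (W.quadraticTwist (NumberField.discr K : ℚ)).entireLFunction 1 ≠ 0 ∧
        WeierstrassCurve.Affine.Point.map ι.toRatAlgHom P = heegnerPointComplex Dt H ∧ ¬ (p : ℤ) ∣ Dt.c ∧
        -- (i) at THIS frame, if it is deep, a refined-Kolyvagin certificate of level ≤ t (a shallow frame certifies itself)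
        ((∃ (d₁ : KolyvaginHeegnerData Dt H.β ι 1) (y : (W.baseChange K).toAffine.Point),
            WeierstrassCurve.Affine.Point.map (W' := W) (algebraMap K (ringClassField K ι 1)).toRatAlgHom y =
              d₁.derivedPoint ∧
            ∃ Q : (W.baseChange K).toAffine.Point, ((p ^ (padicValNat p W.tamagawaProduct + 1) : ℕ) : ℤ) • Q = y) →
          ∃ M : ℕ, M ≤ padicValNat p W.tamagawaProduct ∧ CertificateAt Dt H.β ι p M) ∧
        -- (ii) analytic μ = 0 (19948's allowable-root clause) at the globally minimal models of THIS twist E^{(d_K)}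
        (∀ (Wd : WeierstrassCurve ℚ) [Wd.IsElliptic] [Wd.IsGloballyMinimal] (Cd : VariableChange ℚ),
          Cd • W.quadraticTwist (NumberField.discr K : ℚ) = Wd →
          ClassX11a Wd p → ¬ Surj Wd p → p ∣ padicValInt p Wd.minimalDiscriminantInt →
          ∀ {N : ℕ} [NeZero N] (f : CuspForm (Gamma0 N) 2), IsNewformOf Wd f →
          ∀ (ϖ : ℚ), (ϖ : ℝ) * Wd.realPeriodRat = plusPeriod f →
          ∀ (a : ℚ_[p]) (L : PowerSeries ℚ_[p]),
            (Wd.HasSplitMultiplicativeReductionAtPrime p → a = 1) →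
            (¬ Wd.HasSplitMultiplicativeReductionAtPrime p → a = -1) →
            IsMultPAdicLFunctionOf f p a L →
            ∃ n : ℕ, ‖PowerSeries.coeff n (PowerSeries.C ((ϖ : ℚ) : ℚ_[p]) * L)‖ = 1)) :
    Summit.BirchSwinnertonDyer.BirchSwinnertonDyer.Theses.ErratumRoadFive.NonSurjCorner := by
  intro W _ _ p _ hX hns h57 hv hnr
  have hp5 : 5 ≤ p := by rcases h57 with h | h <;> omega
  -- the X11a lower half at every NON-SURJECTIVE X11a LEAF twin at `p`: trivial at a unit `#Ш_an`, `h₄ℓ` otherwise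
  have h₄ : ∀ (Wd : WeierstrassCurve ℚ) [Wd.IsElliptic] [Wd.IsGloballyMinimal], ClassX11a Wd p → ¬ Surj Wd p →
      p ∣ padicValInt p Wd.minimalDiscriminantInt → Typed.MissingLowerBoundAt Wd p := fun Wd _ _ hXa hnsd hvd ↦ by
    by_cases hu : X11a.ShaAnUnit Wd p
    · obtain ⟨q, hq, hvq⟩ := hu
      exact ⟨q, hq, by rw [hvq]; exact_mod_cast Nat.zero_le _⟩
    · exact h₄ℓ Wd p hXa hnsd h57 hvd hu
  haveI : NeZero (W.conductorNorm ℤ) := ⟨(W.conductorNorm_pos_holds).ne'⟩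
  -- the UPPER half, by CARRIER PROFILE (as in p579499 ∕ p630826) — no Kato input here
  have hupper : Typed.MissingUpperBoundAt W p := by
    by_cases hcase : ¬ p ∣ W.tamagawaProduct ∨
        ∃ v : HeightOneSpectrum (𝓞 ℚ), padicValNat p W.tamagawaProduct ≤ padicValNat p (W.tamagawaNumberAt v)
    · refine missingUpperBoundAt_corner_of_jetchevDivisibility_of_twinLeafLower_of_casselsTate' hGZ hKo hGZK hmod hnf hFHs hMaz
        hrec hD36 hCT h372 W p hX hns h57 hv hnr (fun Wd _ _ hXa hnsd hvd ↦ h₄ Wd hXa hnsd hvd) ?_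
      intro _ K _ _ Dt β ι hK hdisc hHN hHp hβ hc s hs n d hn hℓ
      rcases hcase with htam | ⟨v, hvt⟩
      · exact Summit.BirchSwinnertonDyer.BirchSwinnertonDyer.Theorems.nonSurjCornerKolyJ_of_not_dvd_tamagawa W p K
          Dt β ι htam hX hns h57 hv hnr hK hdisc hHN hHp hβ hc s hs n d hn hℓ
      · by_cases htam : p ∣ W.tamagawaProduct
        · exact hJmax W p K Dt β ι htam hX hns h57 hv hnr hK hdisc hHN hHp hβ hc v s (hs.trans hvt) n d hn hℓ
        · exact Summit.BirchSwinnertonDyer.BirchSwinnertonDyer.Theorems.nonSurjCornerKolyJ_of_not_dvd_tamagawa W p K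
            Dt β ι htam hX hns h57 hv hnr hK hdisc hHN hHp hβ hc s hs n d hn hℓ
    · push Not at hcase
      exact hUmulti W p hX hns h57 hv hnr hcase.1 hcase.2
  -- the LOWER half: trivial when `ord_p #Ш(E)_an ≤ 0`; otherwise the DEEP WITNESS of this pair (§1)
  obtain ⟨s, hs, hsv⟩ := hupper
  by_cases hs0 : padicValRat p s ≤ 0
  · exact Typed.missingPPartAt_of_lower_of_upper W p (missingLowerBoundAt_of_shaAn_nonpos W p hs hs0) ⟨s, hs, hsv⟩
  have hspos : ∃ s : ℚ, shaAn W = (s : ℂ) ∧ 0 < padicValRat p s := ⟨s, hs, lt_of_not_ge hs0⟩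
  exact Typed.missingPPartAt_of_lower_of_upper W p
    (missingLowerBoundAt_corner_of_deepWitnessAt hGZ hKo hGZK hmod hrec hD36 hChaL W p hX hns h57 hv hnr
      (fun Wd _ _ hXa hnsd hvd hμc ↦ htwU Wd p hXa hnsd hvd hμc) (hWit W p hX hns h57 hv hnr hspos))
    ⟨s, hs, hsv⟩

end Summit.BirchSwinnertonDyer.Rank1Residual.X11b

end
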